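import Literature.NumberTheory.LFunctions.Xiao2020.CertKernel
import HarnessLib

/-!
# Xiao (2020), Conj. 3.4 — kernel evaluation of the interval certificate

`CertKernel.cert` is the integer-interval program (scale `2^176`, Euler–Maclaurin parameters
`N = 40`, `ν = 25`, Cauchy radius `9/10`) that encloses the second differences
`d_n = λ_n − 2λ_{n−1} + λ_{n−2}` of the Keiper–Li coefficients for `3 ≤ n ≤ 119` and checks
`d_n > 0` for `n ≤ 118` and `d_119 < 0`.  This file records the single expensive fact: the kernel
evaluates `cert` to `true` (about one minute of kernel reduction; `Nat`/`Int` arithmetic is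
GMP-accelerated).  The soundness theorem turning this into statements about
`Literature.NumberTheory.LFunctions.keiperLiCoeff` lives in `Xiao2020.CertSound`, the refutation of
Conj. 3.4 of [Xiao2020] in `Xiao2020.Refutation`.
-/

namespace Literature.NumberTheory.LFunctions.Xiao2020.CertKernel

/-- The certificate program evaluates to `true` in the kernel (standard axioms only; no
`native_decide`, no `Decidable` shortcuts beyond `decide +kernel` on a closed `Bool` term).
[cite: Xiao2020, Conj. 3.4] -/
theorem cert_true : cert = true := by decide +kernel

end Literature.NumberTheory.LFunctions.Xiao2020.CertKernel
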